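import Summits.QuantumFields.BalabanUV.Beta.NVertexColumnK1Row
import Summits.QuantumFields.BalabanUV.Beta.NVertexLamSectorContracted
import Summits.QuantumFields.BalabanUV.Beta.CoDressedMmRead

/-!
# `BalabanUV.Beta.NVertexLamK1Prime` — binder row D1 ∕ (C1), PART 28: **(K1′) AT EVERY DEPTH, BY KERNEL — THE CONTRACTED MULTIPLIER RESPONSE OF THE COMPOSITE COLUMN IS
# MINUS THE COMPOSITE CHART's OWN MULTIPLIER–MULTIPLIER BLOCK: `Λ′_N μ y ν w = −(AN R j) (L•w) (L•y) (inr ν) (inr μ)` (`κ₁ = −1`), BECAUSE THAT BLOCK IS THE STRAIGHT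
# `KInv`'s `wΦ ν μ (w − y)` (the corrector `Ψ̂` and the block-mean co-dressing `Π_bm` do not touch multiplier indices); HENCE THE Λ SECTOR OF THE N-VERTEX IS
# `ℒN μ y = Σ_ν Σ'_w (AN R j) (L•w) (L•y) (inr ν) (inr μ) · compH ν w` — the chart's multiplier column superposed with the composite constraint Hessians, road FP's (J-ΛS) on `ℤ⁴`**

WHY (journal [AN2-G69-LANDED-3] J-NOTE-12 §3 (K1′), road FP g46 PART 3b v1.2 `TowerHN2RowMixedWard` (J-ΛS) `hΛS : Λ₁ (r•e_a) = cΛS • Σ_β Ŝ_a β • Ĉ_β`, Engine C K1∕T3 j243974: (K1′)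
INHABITED BY VALUE at depth 1 with `α = −1`).  (J-Λ₂′) factors through (K2b) ∘ (K1′) ∘ one lock (J-NOTE-12 §3); (K2b) is PART 25∕26 (depth 1); (K1′) — «the composite chart's
multiplier column `Ŝ_a(β)` equals the storey-wise `KInv` multiplier response read through `colN̂`» — was by value only.  It is in fact STRUCTURAL at every depth: an2 g63's PART 22
`NVertexColumnK1Row.LamN_eq_neg_HΦcol` gives `Λ′_N μ y ν w = −Φ^ℋ_L(ν, w; μ, y) = −wΦ ν μ (w − y)`, and the chart `AN R j = compChart … = Ψ̂ ∘ coDressKBmAt s L KInv ∘ Ψ̂ᵀ`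
(`CompositeOneShotJetData.AN_eq`) has the SAME multiplier–multiplier block as `KInv` (K-U3d L2's apply bridges `comp_psiK_inr ∕ comp_trK_psiK_inr`, an2's `coDressKBmAt_inr_inr`),
which at coarse points is `wΦ` (lit `KInv_inr_inr_coarse`).  So `κ₁ = −1` exactly — Engine C's by-value `−1` was the kernel's.

WHAT ([folklore] bookkeeping BY NAME; no `def`, no `def … : Prop`, nothing cited, 0 sorry; `L = Lc^(j+1)`, any roots `R`, any depth `j`):
§1 **`AN_inr_inr_smul`** (`(AN R j) (L•w) (L•y) (inr ν) (inr μ) = wΦ ν μ (w − y)`), `AN_inr_inr_smul_eq_HΦcol` (`= Φ^ℋ_L(ν, w; μ, y)`);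
§2 **`LamN_eq_neg_AN_inr_inr`** ((K1′): `Σ_{κ′} Σ'_u (AN R j) u (L•y) (inl κ′) (inr μ) · lamCoeffOf (KInv L) L ν w κ′ u = −(AN R j) (L•w) (L•y) (inr ν) (inr μ)`);
§3 **`LN_eq_sum_AN_inr_inr_mul_compH`** (`ℒN μ y x z a b = Σ_ν Σ'_w (AN R j) (L•w) (L•y) (inr ν) (inr μ) · compH R.r Lc (j+1) ν w x z a b` — PART 14 `LN_inl_inl_contracted` with (K1′)),
**`VN_inl_inl_wilson_add_multCol`** (`VN|ff = cE·𝒲N|ff + cΛ·Σ_ν Σ'_w (AN)_{mm}(w; y)·compH ν w|ff` — the N-vertex's field block is the Wilson sector plus the chart's MULTIPLIER COLUMN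
against the composite constraint Hessians: (J-ΛS)'s lattice form with `cΛS`-before-pins `= cΛ (j+1)`, sign `+`).
WHAT THIS IS NOT: not the torus∕periodised (J-ΛS) (the fold of `Σ'_w` onto `pbox M × Fin 4` with coarse copies + `perF` of the `mm` block — road∕row bookkeeping in PART 23's
style, next); not v6's `Λ₁` pin; not (K2b) at depth ≥ 2; nothing of Bałaban's asserted, valued or discharged; 0 estimates; 0∕4 row-D1 binders (hW, hR, D1Tel, D1Rep); ROOT M‴ p325680 ∕
P5c ∕ D6 untouched; NOT (C1), NOT (T-ID), NOT D1, NEVER «G-an2-4 closed», NOT BetaPertH, NOT continuum, NOT Clay.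

HONEST DEPENDENCY (page 1, mandatory): continuum YM on T⁴ ⇐ BetaPertH ∧ nine spine estimates (0/9 proved); BetaPertH ⇐ (D1) ∧ (D4) ∧ CAP+tail;
G-an2-4 gates asym, D1 and NE2/3/4.  HONEST FRAMING (cell contract, verbatim): «discharging `BetaPertH` makes Bałaban's UV stability UNCONDITIONAL —
a real constructive-QFT result; it is NOT the continuum limit and NOT the Clay problem.»  ABSOLUTE RULE (cell charter, verbatim): «No internally-minted
statement may enter as a cited fact. Every hypothesis is either kernel-proved in this package or a verbatim quotation of a PUBLISHED theorem with page
reference. The manuscript(s) under audit are NOT citable for their own disputed steps — they are the thing under adjudication; programme-internal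
(2001/route/tribunal) claims are never citable.»  Row D1 ∕ (C1) OWNER an2 (b2b-balaban-beta-an2) gen 70, 2026-08-28.  No existing file touched.
-/

noncomputable section

open scoped BigOperators

namespace Summit.QuantumFields.BalabanUV.Beta.NVertexLamK1Prime

open Finset
open Literature.MathematicalPhysics.QuantumFieldTheory
open Literature.MathematicalPhysics.QuantumFieldTheory.Balaban1983to89
open Literature.MathematicalPhysics.QuantumFieldTheory.Balaban1983to89.Beta
open AffineAveraging (Site toSite)
open ExpKernelCalculus (MKer comp)
open OneStepResolventKernel (Fib KInv KInv_inr_inr_coarse)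
open KernelSpecInstance (wΦ)
open ResolventComposition (HΦcol HΦcol_apply)
open BalabanStepJets (lamCoeffOf)
open InterLevelTransport (SLam)
open OneStepKernelFamily (vertexOfK)
open StepJetData (wilsonA)
open Summit.QuantumFields.BalabanUV.Beta.TameKernelCalculus (trK)
open Summit.QuantumFields.BalabanUV.Beta.AxialDressingRooted (coDressKBmAt coDressKBmAt_inr_inr)
open Summit.QuantumFields.BalabanUV.Beta.CompositeCorrectorKernel (psiK comp_psiK_inr comp_trK_psiK_inr)
open Summit.QuantumFields.BalabanUV.Beta.CompositeCorrectorDress (compChart)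
open Summit.QuantumFields.BalabanUV.Beta.CompositeOneShotJets (compH)
open Summit.QuantumFields.BalabanUV.Beta.CompositeOneShotJetData (Roots Pins AN VN AN_eq)
open Summit.QuantumFields.BalabanUV.Beta.NVertexColumnK1Row (LamN_eq_neg_HΦcol)
open Summit.QuantumFields.BalabanUV.Beta.NVertexLamSectorContracted (LN_inl_inl_contracted VN_inl_inl_contracted summable_LamN)

variable {Lc : ℕ} [NeZero Lc] (R : Roots Lc) (j : ℕ)

/-! ## §1 The composite chart's multiplier–multiplier block is the straight `KInv`'s -/

/-- [folklore] **`AN_inr_inr_smul` — THE MULTIPLIER–MULTIPLIER BLOCK OF THE COMPOSITE ONE-SHOT CHART AT COARSE POINTS IS THE STRAIGHT SYSTEM's MULTIPLIER RESPONSE**: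
`(AN R j) (L•w) (L•y) (inr ν) (inr μ) = wΦ ν μ (w − y)` (`AN = Ψ̂ ∘ coDressKBmAt s L KInv ∘ Ψ̂ᵀ`; `Ψ̂`, `Π_bm` fix multiplier indices; lit `KInv_inr_inr_coarse`). -/
theorem AN_inr_inr_smul (ν μ : Fin (3 + 1)) (w y : Site (3 + 1)) :
    AN R j (((Lc ^ (j + 1) : ℕ) : ℤ) • w) (((Lc ^ (j + 1) : ℕ) : ℤ) • y) (Sum.inr ν) (Sum.inr μ)
      = wΦ (N := Lc ^ (j + 1)) ν μ (w - y) := by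
  rw [AN_eq]
  unfold CompositeCorrectorDress.compChart
  rw [comp_trK_psiK_inr, comp_psiK_inr, coDressKBmAt_inr_inr, KInv_inr_inr_coarse]

/-- [folklore] … equivalently the straight column's own multiplier `Φ^ℋ_L(ν, w; μ, y)` (`ResolventComposition.HΦcol`). -/
theorem AN_inr_inr_smul_eq_HΦcol (ν μ : Fin (3 + 1)) (w y : Site (3 + 1)) :
    AN R j (((Lc ^ (j + 1) : ℕ) : ℤ) • w) (((Lc ^ (j + 1) : ℕ) : ℤ) • y) (Sum.inr ν) (Sum.inr μ)
      = HΦcol (N := Lc ^ (j + 1)) μ y ν w := by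
  rw [AN_inr_inr_smul, HΦcol_apply]

/-! ## §2 (K1′) at every depth -/

/-- [folklore] **`LamN_eq_neg_AN_inr_inr` — (K1′) BY KERNEL, EVERY DEPTH, `κ₁ = −1`**: the contracted multiplier response of the composite column along the source `(μ, y)`, read at the
coarse bond `(ν, w)`, is MINUS the chart's own multiplier–multiplier entry:
`Σ_{κ′} Σ'_u (AN R j) u (L•y) (inl κ′) (inr μ) · lamCoeffOf (KInv L) L ν w κ′ u = −(AN R j) (L•w) (L•y) (inr ν) (inr μ)` (PART 22 `LamN_eq_neg_HΦcol` + §1). -/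
theorem LamN_eq_neg_AN_inr_inr (μ ν : Fin (3 + 1)) (y w : Site (3 + 1)) :
    (∑ κ' : Fin (3 + 1), ∑' u : Site (3 + 1),
        AN R j u (((Lc ^ (j + 1) : ℕ) : ℤ) • y) (Sum.inl κ') (Sum.inr μ) * lamCoeffOf (KInv (N := Lc ^ (j + 1)) (d := 3)) (Lc ^ (j + 1)) ν w κ' u)
      = -AN R j (((Lc ^ (j + 1) : ℕ) : ℤ) • w) (((Lc ^ (j + 1) : ℕ) : ℤ) • y) (Sum.inr ν) (Sum.inr μ) := by
  rw [LamN_eq_neg_HΦcol, AN_inr_inr_smul_eq_HΦcol]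

/-! ## §3 The Λ sector of the N-vertex: the chart's multiplier column against the composite constraint Hessians -/

/-- [folklore] **`LN_eq_sum_AN_inr_inr_mul_compH` — THE Λ SECTOR IS THE MULTIPLIER COLUMN SUPERPOSED WITH THE COMPOSITE CONSTRAINT HESSIANS** (every block):
`ℒN μ y x z a b = Σ_ν Σ'_w (AN R j) (L•w) (L•y) (inr ν) (inr μ) · compH R.r Lc (j+1) ν w x z a b` (PART 14 `LN_inl_inl_contracted` with (K1′)). -/
theorem LN_eq_sum_AN_inr_inr_mul_compH (μ : Fin (3 + 1)) (y x z : Site (3 + 1)) (a b : Fib 3) :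
    vertexOfK (AN R j) (Lc ^ (j + 1))
        (SLam (Lc ^ (j + 1)) (lamCoeffOf (KInv (N := Lc ^ (j + 1)) (d := 3)) (Lc ^ (j + 1))) (compH R.r Lc (j + 1))) μ y x z a b
      = ∑ ν : Fin (3 + 1), ∑' w : Site (3 + 1),
          AN R j (((Lc ^ (j + 1) : ℕ) : ℤ) • w) (((Lc ^ (j + 1) : ℕ) : ℤ) • y) (Sum.inr ν) (Sum.inr μ) * compH R.r Lc (j + 1) ν w x z a b := by
  rw [LN_inl_inl_contracted, ← Finset.sum_neg_distrib]
  refine Finset.sum_congr rfl fun ν _ => ?_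
  rw [← tsum_neg]
  exact tsum_congr fun w => by rw [LamN_eq_neg_AN_inr_inr, neg_mul, neg_neg]

/-- [folklore] **`VN_inl_inl_wilson_add_multCol` — THE FIELD BLOCK OF THE N-VERTEX: WILSON SECTOR PLUS THE MULTIPLIER COLUMN AGAINST THE COMPOSITE CONSTRAINT HESSIANS**:
`VN R P j μ y x z (inl α) (inl β) = cE (j+1)·𝒲N μ y x z (inl α) (inl β) + cΛ (j+1)·Σ_ν Σ'_w (AN R j) (L•w) (L•y) (inr ν) (inr μ) · compH R.r Lc (j+1) ν w x z (inl α) (inl β)` —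
road FP's (J-ΛS) on `ℤ⁴` (coefficient `cΛ (j+1)`, sign `+`; the torus fold is the instantiation's bookkeeping). -/
theorem VN_inl_inl_wilson_add_multCol (P : Pins) (μ : Fin (3 + 1)) (y x z : Site (3 + 1)) (α β : Fin (3 + 1)) :
    VN R P j μ y x z (Sum.inl α) (Sum.inl β)
      = P.cE (j + 1) * vertexOfK (AN R j) (Lc ^ (j + 1)) (wilsonA 3) μ y x z (Sum.inl α) (Sum.inl β)
        + P.cΛ (j + 1) * ∑ ν : Fin (3 + 1), ∑' w : Site (3 + 1),
            AN R j (((Lc ^ (j + 1) : ℕ) : ℤ) • w) (((Lc ^ (j + 1) : ℕ) : ℤ) • y) (Sum.inr ν) (Sum.inr μ) * compH R.r Lc (j + 1) ν w x z (Sum.inl α) (Sum.inl β) := by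
  rw [VN_inl_inl_contracted, sub_eq_add_neg, ← mul_neg, ← Finset.sum_neg_distrib]
  congr 2
  refine Finset.sum_congr rfl fun ν _ => ?_
  rw [← tsum_neg]
  exact tsum_congr fun w => by rw [LamN_eq_neg_AN_inr_inr, neg_mul, neg_neg]

end Summit.QuantumFields.BalabanUV.Beta.NVertexLamK1Prime

end
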